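import Mathlib
import Summits.Ventures.PercRepro2.Defs
import Summits.Ventures.PercRepro2.Independence
import Summits.Ventures.PercRepro2.Harris
import Summits.Ventures.PercRepro2.Graph
import Summits.Ventures.PercRepro2.Events
import Summits.Ventures.PercRepro2.PartitionThree
import Summits.Ventures.PercRepro2.ZCTwoEdge
import Summits.Ventures.PercRepro2.ZCLeafReductions
import Summits.Ventures.PercRepro2.ZCLeafReductionsGraph
import Summits.Ventures.PercRepro2.ZCZeroWeight

/-!
# The leaf reductions of (ZC) for a `p`-leaf: other edges at the leaf may exist with weight `0`
(blind cell PercRepro2, mine-a g23; MINE-A.md §70.6)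

`zc_leaf_o_graph'` and `zc_leaf_a3_graph'` are `zc_leaf_o_graph` / `zc_leaf_a3_graph` with the
hypothesis «`f` is the only edge at the leaf» weakened to «every other edge at the leaf has weight
`0`» (`hleaf : ∀ e, ℓ ∈ ends e → e = f ∨ p e = 0`).  This is what iterating the reductions needs:
after a reduction the next leaf is a leaf of the positive-weight subgraph only.  Proof: close the
zero-weight edges at the leaf (`prob_eq_closeSet`), then run the pointwise structural lemmas of
`ZCZeroWeight` and the abstract theorems.  One seat.
-/

namespace Summit.Ventures.PercRepro2

section Pullback

variable {E : Type*} [DecidableEq E]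

/-- Pulling back an intersection along the closing map. -/
lemma closeSet_setOf_inter (Z : Finset E) (f : E) (A B : Set (Config E)) :
    {ω : Config E | Function.update (Z.piecewise (fun _ => false) ω) f false ∈ A ∩ B}
      = {ω | Function.update (Z.piecewise (fun _ => false) ω) f false ∈ A}
        ∩ {ω | Function.update (Z.piecewise (fun _ => false) ω) f false ∈ B} := rfl

/-- Pulling back a complement along the closing map. -/
lemma closeSet_setOf_compl (Z : Finset E) (f : E) (A : Set (Config E)) :
    {ω : Config E | Function.update (Z.piecewise (fun _ => false) ω) f false ∈ Aᶜ}
      = {ω | Function.update (Z.piecewise (fun _ => false) ω) f false ∈ A}ᶜ := rfl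

/-- Pulling back an intersection along `closeSet` alone. -/
lemma closeSet_setOf_inter₀ (Z : Finset E) (A B : Set (Config E)) :
    {ω : Config E | Z.piecewise (fun _ => false) ω ∈ A ∩ B}
      = {ω | Z.piecewise (fun _ => false) ω ∈ A} ∩ {ω | Z.piecewise (fun _ => false) ω ∈ B} := rfl

/-- Pulling back a complement along `closeSet` alone. -/
lemma closeSet_setOf_compl₀ (Z : Finset E) (A : Set (Config E)) :
    {ω : Config E | Z.piecewise (fun _ => false) ω ∈ Aᶜ}
      = {ω | Z.piecewise (fun _ => false) ω ∈ A}ᶜ := rfl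

end Pullback

section LeafGraphP

variable {V : Type*} [DecidableEq V] {E : Type*} [Fintype E] [DecidableEq E] {R : Type*}
  [CommRing R] [LinearOrder R] [IsStrictOrderedRing R]

/-- **(L_o) for a `p`-leaf.**  `o` is joined to the rest by `f = zo` and by edges of weight `0`
only.  Same conclusion as `zc_leaf_o_graph`. -/
theorem zc_leaf_o_graph' {p : E → R} (hp : IsProbVec p) {ends : E → Sym2 V} {a₁ a₃ o z : V}
    {f : E} (hends : ends f = s(z, o)) (hleaf : ∀ e, o ∈ ends e → e = f ∨ p e = 0) (ho1 : o ≠ a₁)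
    (ho3 : o ≠ a₃) (hoz : o ≠ z) {𝓔 : Set (Set V)} (h𝓔 : IsUpperSet 𝓔) :
    let e := connEvent ends a₁ a₃
    let L := connEvent ends a₁ o
    let U := clusterInEvent ends a₁ 𝓔
    let γ := connEvent ends a₃ o
    let p' := Function.update p f 0
    let 𝓔z : Set (Set V) := {S | (z ∈ S ∧ insert o S ∈ 𝓔) ∨ (z ∉ S ∧ S ∈ 𝓔)}
    let e' := connEvent ends a₁ a₃
    let L' := connEvent ends a₁ z
    let U' := clusterInEvent ends a₁ 𝓔z
    let γ' := connEvent ends a₃ z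
    prob p (eᶜ ∩ Lᶜ ∩ γᶜ) * (prob p (U ∩ (e ∩ L)) - prob p U * prob p (e ∩ L))
      - prob p (eᶜ ∩ Lᶜ ∩ γ) * (prob p (U ∩ (e ∩ Lᶜ)) - prob p U * prob p (e ∩ Lᶜ))
      ≥ p f * (prob p' (e'ᶜ ∩ L'ᶜ ∩ γ'ᶜ) * (prob p' (U' ∩ (e' ∩ L')) - prob p' U' * prob p' (e' ∩ L'))
          - prob p' (e'ᶜ ∩ L'ᶜ ∩ γ') * (prob p' (U' ∩ (e' ∩ L'ᶜ)) - prob p' U' * prob p' (e' ∩ L'ᶜ))) := by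
  intro e L U γ p' 𝓔z e' L' U' γ'
  have hzo : z ≠ o := Ne.symm hoz
  -- the zero-weight edges at `o`
  set Z : Finset E := Finset.univ.filter (fun e => e ≠ f ∧ o ∈ ends e) with hZdef
  have hZ0 : ∀ e ∈ Z, p e = 0 := by
    intro e he
    simp only [hZdef, Finset.mem_filter, Finset.mem_univ, true_and] at he
    rcases hleaf e he.2 with h | h
    · exact absurd h he.1
    · exact h
  have hfZ : f ∉ Z := by simp [hZdef]
  have hpt : ∀ ω : Config E, ∀ e, o ∈ ends e → e = f ∨ Z.piecewise (fun _ => false) ω e = false := by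
    intro ω e he
    by_cases hef : e = f
    · exact Or.inl hef
    · right
      apply closeSet_apply_of_mem
      simp [hZdef, hef, he]
  have htr : ∀ A : Set (Config E), prob p A = prob p {ω | Z.piecewise (fun _ => false) ω ∈ A} :=
    prob_eq_closeSet p Z hZ0
  have hcf : ∀ ω : Config E, Z.piecewise (fun _ => false) ω f = ω f :=
    fun ω => closeSet_apply_of_not_mem Z ω hfZ
  -- the `ω⁻`-events, pulled back along the closing map
  set E' : Set (Config E) := {ω | Function.update (Z.piecewise (fun _ => false) ω) f false ∈ e'} with hE'
  set Lz : Set (Config E) := {ω | Function.update (Z.piecewise (fun _ => false) ω) f false ∈ L'} with hLz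
  set γz : Set (Config E) := {ω | Function.update (Z.piecewise (fun _ => false) ω) f false ∈ γ'} with hγz
  set X₀ : Set (Config E) := {ω | Function.update (Z.piecewise (fun _ => false) ω) f false ∈ U} with hX₀
  set Xz : Set (Config E) := {ω | Function.update (Z.piecewise (fun _ => false) ω) f false ∈ U'} with hXz
  -- the graph events (pulled back) in the abstract form
  have he : {ω | Z.piecewise (fun _ => false) ω ∈ e} = E' := by
    ext ω
    simp only [e, E', e', Set.mem_setOf_eq, mem_connEvent]
    exact conn_leaf_iff_of_ne' hends hzo (hpt ω) (Ne.symm ho1) (Ne.symm ho3)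
  have hL : {ω | Z.piecewise (fun _ => false) ω ∈ L} = openEdge f ∩ Lz := by
    ext ω
    simp only [L, Lz, L', Set.mem_inter_iff, Set.mem_setOf_eq, mem_connEvent, mem_openEdge]
    rw [conn_leaf_iff' hends hzo (hpt ω) (Ne.symm ho1), hcf]
  have hγ : {ω | Z.piecewise (fun _ => false) ω ∈ γ} = openEdge f ∩ γz := by
    ext ω
    simp only [γ, γz, γ', Set.mem_inter_iff, Set.mem_setOf_eq, mem_connEvent, mem_openEdge]
    rw [conn_leaf_iff' hends hzo (hpt ω) (Ne.symm ho3), hcf]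
  have hU : {ω | Z.piecewise (fun _ => false) ω ∈ U} = (openEdge f ∩ Xz) ∪ (closedEdge f ∩ X₀) := by
    ext ω
    simp only [U, Xz, X₀, U', 𝓔z, Set.mem_union, Set.mem_inter_iff, Set.mem_setOf_eq,
      mem_clusterInEvent, mem_openEdge, mem_closedEdge]
    rw [cluster_leaf_eq' hends hzo (hpt ω) (Ne.symm ho1), hcf]
    rcases Bool.eq_false_or_eq_true (ω f) with hf | hf
    · by_cases hz : z ∈ cluster ends (Function.update (Z.piecewise (fun _ => false) ω) f false) a₁
      · have hset : cluster ends (Function.update (Z.piecewise (fun _ => false) ω) f false) a₁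
            ∪ {u | u = o ∧ ω f = true ∧ z ∈ cluster ends (Function.update (Z.piecewise (fun _ => false) ω) f false) a₁}
            = insert o (cluster ends (Function.update (Z.piecewise (fun _ => false) ω) f false) a₁) := by
          ext u; simp [hf, hz]
        rw [hset]; simp [hf, hz]
      · have hset : cluster ends (Function.update (Z.piecewise (fun _ => false) ω) f false) a₁
            ∪ {u | u = o ∧ ω f = true ∧ z ∈ cluster ends (Function.update (Z.piecewise (fun _ => false) ω) f false) a₁}
            = cluster ends (Function.update (Z.piecewise (fun _ => false) ω) f false) a₁ := by
          ext u; simp [hz]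
        rw [hset]; simp [hf, hz]
    · have hset : cluster ends (Function.update (Z.piecewise (fun _ => false) ω) f false) a₁
          ∪ {u | u = o ∧ ω f = true ∧ z ∈ cluster ends (Function.update (Z.piecewise (fun _ => false) ω) f false) a₁}
          = cluster ends (Function.update (Z.piecewise (fun _ => false) ω) f false) a₁ := by
        ext u; simp [hf]
      rw [hset]; simp [hf]
  -- invariance under forcing `f`
  have inv : ∀ (A : Set (Config E)) (ω : Config E) (b : Bool),
      Function.update ω f b ∈ {ω | Function.update (Z.piecewise (fun _ => false) ω) f false ∈ A} ↔
        ω ∈ {ω | Function.update (Z.piecewise (fun _ => false) ω) f false ∈ A} := by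
    intro A ω b
    simp only [Set.mem_setOf_eq, closeSet_update Z hfZ, Function.update_idem]
  -- monotonicity
  have hmono : ∀ {ω ω' : Config E}, ω ≤ ω' →
      Function.update (Z.piecewise (fun _ => false) ω) f false
        ≤ Function.update (Z.piecewise (fun _ => false) ω') f false :=
    fun hle => closeOne_mono f (closeSet_mono Z hle)
  have hE'up : IsUpperSet E' := fun ω ω' hle hω => conn_mono (hmono hle) hω
  have hLzup : IsUpperSet Lz := fun ω ω' hle hω => conn_mono (hmono hle) hω
  have h𝓔zup : IsUpperSet 𝓔z := by
    intro S S' hSS' hS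
    rcases hS with ⟨hzS, hS⟩ | ⟨hzS, hS⟩
    · exact Or.inl ⟨hSS' hzS, h𝓔 (Set.insert_subset_insert hSS') hS⟩
    · by_cases hz' : z ∈ S'
      · exact Or.inl ⟨hz', h𝓔 ((hSS'.trans (Set.subset_insert _ _))) hS⟩
      · exact Or.inr ⟨hz', h𝓔 hSS' hS⟩
  have hXzup : IsUpperSet Xz := fun ω ω' hle hω => h𝓔zup (cluster_mono (hmono hle) a₁) hω
  have hX : X₀ ⊆ Xz := by
    intro ω hω
    simp only [Xz, X₀, U, U', 𝓔z, Set.mem_setOf_eq, mem_clusterInEvent] at hω ⊢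
    by_cases hz : z ∈ cluster ends (Function.update (Z.piecewise (fun _ => false) ω) f false) a₁
    · exact Or.inl ⟨hz, h𝓔 (Set.subset_insert _ _) hω⟩
    · exact Or.inr ⟨hz, hω⟩
  -- (P1) on `G − o` for the marks `(a₁, a₃, z)`
  have hp' : IsProbVec p' := hp.update f le_rfl zero_le_one
  have htr' : ∀ A : Set (Config E), prob p' A
      = prob p {ω | Function.update (Z.piecewise (fun _ => false) ω) f false ∈ A} := by
    intro A
    rw [prob_update_zero_eq_shift, htr]
    rfl
  have hP1 : prob p (E'ᶜ ∩ Lzᶜ ∩ γz) * prob p (E' ∩ Lzᶜ)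
      ≤ prob p (E'ᶜ ∩ Lzᶜ ∩ γzᶜ) * prob p (E' ∩ Lz) := by
    have h := partitionThree_lattice hp' ends a₁ a₃ z
    rw [partBCa_eq_three, partAll_eq_ab_ac] at h
    simp only [partABc, partApart, htr', closeSet_setOf_inter, closeSet_setOf_compl] at h
    simp only [hE', hLz, hγz, e', L', γ']
    linarith [h]
  -- the abstract theorem
  have key := zc_leaf_o hp f (inv e') (inv L') (inv γ') (inv U) (inv U') hE'up hLzup hXzup hX hP1
  simp only at key
  -- transport the left-hand side along the closing map
  rw [htr (eᶜ ∩ Lᶜ ∩ γᶜ), htr (U ∩ (e ∩ L)), htr U, htr (e ∩ L), htr (eᶜ ∩ Lᶜ ∩ γ),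
    htr (U ∩ (e ∩ Lᶜ)), htr (e ∩ Lᶜ)]
  simp only [closeSet_setOf_inter₀, closeSet_setOf_compl₀]
  rw [he, hL, hU, hγ]
  simp only [hE', hLz, hγz, hX₀, hXz] at key ⊢
  simp only [htr', closeSet_setOf_inter, closeSet_setOf_compl]
  exact key

/-- **(L₃) for a `p`-leaf.**  `a₃` is joined to the rest by `f = z'a₃` and by edges of weight `0`
only.  Same conclusion as `zc_leaf_a3_graph`. -/
theorem zc_leaf_a3_graph' {p : E → R} (hp : IsProbVec p) {ends : E → Sym2 V} {a₁ a₃ o z : V}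
    {f : E} (hends : ends f = s(z, a₃)) (hleaf : ∀ e, a₃ ∈ ends e → e = f ∨ p e = 0) (h31 : a₃ ≠ a₁)
    (h3o : a₃ ≠ o) (h3z : a₃ ≠ z) {𝓔 : Set (Set V)} (h𝓔 : IsUpperSet 𝓔) :
    let e := connEvent ends a₁ a₃
    let L := connEvent ends a₁ o
    let U := clusterInEvent ends a₁ 𝓔
    let γ := connEvent ends a₃ o
    let p' := Function.update p f 0
    let 𝓔z : Set (Set V) := {S | (z ∈ S ∧ insert a₃ S ∈ 𝓔) ∨ (z ∉ S ∧ S ∈ 𝓔)}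
    let e' := connEvent ends a₁ z
    let L' := connEvent ends a₁ o
    let U' := clusterInEvent ends a₁ 𝓔z
    let γ' := connEvent ends z o
    prob p (eᶜ ∩ Lᶜ ∩ γᶜ) * (prob p (U ∩ (e ∩ L)) - prob p U * prob p (e ∩ L))
      - prob p (eᶜ ∩ Lᶜ ∩ γ) * (prob p (U ∩ (e ∩ Lᶜ)) - prob p U * prob p (e ∩ Lᶜ))
      ≥ p f * p f * (prob p' (e'ᶜ ∩ L'ᶜ ∩ γ'ᶜ) * (prob p' (U' ∩ (e' ∩ L')) - prob p' U' * prob p' (e' ∩ L'))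
          - prob p' (e'ᶜ ∩ L'ᶜ ∩ γ') * (prob p' (U' ∩ (e' ∩ L'ᶜ)) - prob p' U' * prob p' (e' ∩ L'ᶜ))) := by
  intro e L U γ p' 𝓔z e' L' U' γ'
  have hz3 : z ≠ a₃ := Ne.symm h3z
  set Z : Finset E := Finset.univ.filter (fun e => e ≠ f ∧ a₃ ∈ ends e) with hZdef
  have hZ0 : ∀ e ∈ Z, p e = 0 := by
    intro e he
    simp only [hZdef, Finset.mem_filter, Finset.mem_univ, true_and] at he
    rcases hleaf e he.2 with h | h
    · exact absurd h he.1
    · exact h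
  have hfZ : f ∉ Z := by simp [hZdef]
  have hpt : ∀ ω : Config E, ∀ e, a₃ ∈ ends e → e = f ∨ Z.piecewise (fun _ => false) ω e = false := by
    intro ω e he
    by_cases hef : e = f
    · exact Or.inl hef
    · right
      apply closeSet_apply_of_mem
      simp [hZdef, hef, he]
  have htr : ∀ A : Set (Config E), prob p A = prob p {ω | Z.piecewise (fun _ => false) ω ∈ A} :=
    prob_eq_closeSet p Z hZ0
  have hcf : ∀ ω : Config E, Z.piecewise (fun _ => false) ω f = ω f :=
    fun ω => closeSet_apply_of_not_mem Z ω hfZ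
  set Ez : Set (Config E) := {ω | Function.update (Z.piecewise (fun _ => false) ω) f false ∈ e'} with hEz
  set L'' : Set (Config E) := {ω | Function.update (Z.piecewise (fun _ => false) ω) f false ∈ L'} with hL''
  set γz : Set (Config E) := {ω | Function.update (Z.piecewise (fun _ => false) ω) f false ∈ γ'} with hγz
  set X₀ : Set (Config E) := {ω | Function.update (Z.piecewise (fun _ => false) ω) f false ∈ U} with hX₀
  set Xz : Set (Config E) := {ω | Function.update (Z.piecewise (fun _ => false) ω) f false ∈ U'} with hXz
  have he : {ω | Z.piecewise (fun _ => false) ω ∈ e} = openEdge f ∩ Ez := by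
    ext ω
    simp only [e, Ez, e', Set.mem_inter_iff, Set.mem_setOf_eq, mem_connEvent, mem_openEdge]
    rw [conn_leaf_iff' hends hz3 (hpt ω) (Ne.symm h31), hcf]
  have hL : {ω | Z.piecewise (fun _ => false) ω ∈ L} = L'' := by
    ext ω
    simp only [L, L'', L', Set.mem_setOf_eq, mem_connEvent]
    exact conn_leaf_iff_of_ne' hends hz3 (hpt ω) (Ne.symm h31) (Ne.symm h3o)
  have hγ : {ω | Z.piecewise (fun _ => false) ω ∈ γ} = openEdge f ∩ γz := by
    ext ω
    simp only [γ, γz, γ', Set.mem_inter_iff, Set.mem_setOf_eq, mem_connEvent, mem_openEdge]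
    constructor
    · intro h
      obtain ⟨hf, hc⟩ := (conn_leaf_iff' hends hz3 (hpt ω) (Ne.symm h3o)).1 (conn_symm h)
      rw [hcf] at hf
      exact ⟨hf, conn_symm hc⟩
    · rintro ⟨hf, hc⟩
      rw [← hcf ω] at hf
      exact conn_symm ((conn_leaf_iff' hends hz3 (hpt ω) (Ne.symm h3o)).2 ⟨hf, conn_symm hc⟩)
  have hU : {ω | Z.piecewise (fun _ => false) ω ∈ U} = (openEdge f ∩ Xz) ∪ (closedEdge f ∩ X₀) := by
    ext ω
    simp only [U, Xz, X₀, U', 𝓔z, Set.mem_union, Set.mem_inter_iff, Set.mem_setOf_eq,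
      mem_clusterInEvent, mem_openEdge, mem_closedEdge]
    rw [cluster_leaf_eq' hends hz3 (hpt ω) (Ne.symm h31), hcf]
    rcases Bool.eq_false_or_eq_true (ω f) with hf | hf
    · by_cases hz : z ∈ cluster ends (Function.update (Z.piecewise (fun _ => false) ω) f false) a₁
      · have hset : cluster ends (Function.update (Z.piecewise (fun _ => false) ω) f false) a₁
            ∪ {u | u = a₃ ∧ ω f = true ∧ z ∈ cluster ends (Function.update (Z.piecewise (fun _ => false) ω) f false) a₁}
            = insert a₃ (cluster ends (Function.update (Z.piecewise (fun _ => false) ω) f false) a₁) := by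
          ext u; simp [hf, hz]
        rw [hset]; simp [hf, hz]
      · have hset : cluster ends (Function.update (Z.piecewise (fun _ => false) ω) f false) a₁
            ∪ {u | u = a₃ ∧ ω f = true ∧ z ∈ cluster ends (Function.update (Z.piecewise (fun _ => false) ω) f false) a₁}
            = cluster ends (Function.update (Z.piecewise (fun _ => false) ω) f false) a₁ := by
          ext u; simp [hz]
        rw [hset]; simp [hf, hz]
    · have hset : cluster ends (Function.update (Z.piecewise (fun _ => false) ω) f false) a₁
          ∪ {u | u = a₃ ∧ ω f = true ∧ z ∈ cluster ends (Function.update (Z.piecewise (fun _ => false) ω) f false) a₁}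
          = cluster ends (Function.update (Z.piecewise (fun _ => false) ω) f false) a₁ := by
        ext u; simp [hf]
      rw [hset]; simp [hf]
  have inv : ∀ (A : Set (Config E)) (ω : Config E) (b : Bool),
      Function.update ω f b ∈ {ω | Function.update (Z.piecewise (fun _ => false) ω) f false ∈ A} ↔
        ω ∈ {ω | Function.update (Z.piecewise (fun _ => false) ω) f false ∈ A} := by
    intro A ω b
    simp only [Set.mem_setOf_eq, closeSet_update Z hfZ, Function.update_idem]
  have hmono : ∀ {ω ω' : Config E}, ω ≤ ω' →
      Function.update (Z.piecewise (fun _ => false) ω) f false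
        ≤ Function.update (Z.piecewise (fun _ => false) ω') f false :=
    fun hle => closeOne_mono f (closeSet_mono Z hle)
  have hEzup : IsUpperSet Ez := fun ω ω' hle hω => conn_mono (hmono hle) hω
  have hL''up : IsUpperSet L'' := fun ω ω' hle hω => conn_mono (hmono hle) hω
  have h𝓔zup : IsUpperSet 𝓔z := by
    intro S S' hSS' hS
    rcases hS with ⟨hzS, hS⟩ | ⟨hzS, hS⟩
    · exact Or.inl ⟨hSS' hzS, h𝓔 (Set.insert_subset_insert hSS') hS⟩
    · by_cases hz' : z ∈ S'
      · exact Or.inl ⟨hz', h𝓔 ((hSS'.trans (Set.subset_insert _ _))) hS⟩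
      · exact Or.inr ⟨hz', h𝓔 hSS' hS⟩
  have hXzup : IsUpperSet Xz := fun ω ω' hle hω => h𝓔zup (cluster_mono (hmono hle) a₁) hω
  have hX : X₀ ⊆ Xz := by
    intro ω hω
    simp only [Xz, X₀, U, U', 𝓔z, Set.mem_setOf_eq, mem_clusterInEvent] at hω ⊢
    by_cases hz : z ∈ cluster ends (Function.update (Z.piecewise (fun _ => false) ω) f false) a₁
    · exact Or.inl ⟨hz, h𝓔 (Set.subset_insert _ _) hω⟩
    · exact Or.inr ⟨hz, hω⟩
  have hp' : IsProbVec p' := hp.update f le_rfl zero_le_one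
  have htr' : ∀ A : Set (Config E), prob p' A
      = prob p {ω | Function.update (Z.piecewise (fun _ => false) ω) f false ∈ A} := by
    intro A
    rw [prob_update_zero_eq_shift, htr]
    rfl
  have hP1 : prob p (Ezᶜ ∩ L''ᶜ ∩ γz) * prob p (Ez ∩ L''ᶜ)
      ≤ prob p (Ezᶜ ∩ L''ᶜ ∩ γzᶜ) * prob p (Ez ∩ L'') := by
    have h := partitionThree_lattice hp' ends a₁ z o
    rw [partBCa_eq_three, partAll_eq_ab_ac] at h
    simp only [partABc, partApart, htr', closeSet_setOf_inter, closeSet_setOf_compl] at h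
    simp only [hEz, hL'', hγz, e', L', γ']
    linarith [h]
  have key := zc_leaf_a3 hp f (inv e') (inv L') (inv γ') (inv U) (inv U') hEzup hL''up hXzup hX hP1
  simp only at key
  rw [htr (eᶜ ∩ Lᶜ ∩ γᶜ), htr (U ∩ (e ∩ L)), htr U, htr (e ∩ L), htr (eᶜ ∩ Lᶜ ∩ γ),
    htr (U ∩ (e ∩ Lᶜ)), htr (e ∩ Lᶜ)]
  simp only [closeSet_setOf_inter₀, closeSet_setOf_compl₀]
  rw [he, hL, hU, hγ]
  simp only [hEz, hL'', hγz, hX₀, hXz] at key ⊢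
  simp only [htr', closeSet_setOf_inter, closeSet_setOf_compl]
  exact key

end LeafGraphP

end Summit.Ventures.PercRepro2
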